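import Literature.NumberTheory.EllipticCurves.UniversalOrdinaryRing
import HarnessLib

/-!
# The Hasse invariant of the CM curves `y² = x³ + b` (`j = 0`) and `y² = x³ + a x` (`j = 1728`) at an ARBITRARY odd prime `p`
# (Deuring's criterion for `j ∈ {0, 1728}`, explicit form)

Topic `Literature/NumberTheory/EllipticCurves`; namespace `Literature.NumberTheory.EllipticCurves`. THEOREMS ONLY (no definition, no named
fact, no instance, no `sorry`). The tree's Hasse coefficient `WeierstrassCurve.hasseCoeff W p` is the coefficient of `x^{p−1}` in
`(4x³ + b₂x² + 2b₄x + b₆)^{(p−1)/2}` (`FormalGroupHasseInvariantProofs`); for a short curve it is `4^{(p−1)/2}·[x^{p−1}](x³ + ax + b)^{(p−1)/2}`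
(`UniversalOrdinary.hasseCoeff_short`), and the double binomial expansion of the latter is `UniversalOrdinary.coeff_cube_add_pow`. Until now the
tree evaluated it only at `p ∈ {5, 7}` (`EisensteinRootShortModel.hasseCoeff_five_short = 32·a₄`, `hasseCoeff_seven_short = 192·a₆`), which keys
the good ORDINARY model data of the (G)-ordinary additive cells (`PAdicHodge.CMFibreCellsGoodOrdinaryData.hasseCoeff_cmFibre_ne_zero`) to
`p ∈ {5, 7}`. This file evaluates it at EVERY odd prime for the two CM fibres, with `m = (p − 1)/2`:

* `coeff_cube_add_pow_of_a₄_zero` — `[x^{2m}](x³ + b)^m = C(m, 2m/3)·b^{m/3}` if `3 ∣ m`, and `= 0` otherwise;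
* `coeff_cube_add_pow_of_a₆_zero` — `[x^{2m}](x³ + a x)^m = C(m, m/2)·a^{m/2}` if `2 ∣ m`, and `= 0` otherwise;
* ★ `hasseCoeff_jZero_of_three_dvd` / `hasseCoeff_jZero_eq_zero_of_not_three_dvd` — `A_p(y² = x³ + b) = 4^m·C(m, 2m/3)·b^{m/3}` for
  `p ≡ 1 (mod 3)` (`⟺ 3 ∣ m` for odd `p`) and `A_p = 0` for `p ≡ 2 (mod 3)`;
* ★ `hasseCoeff_j1728_of_two_dvd` / `hasseCoeff_j1728_eq_zero_of_not_two_dvd` — `A_p(y² = x³ + a x) = 4^m·C(m, m/2)·a^{m/2}` for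
  `p ≡ 1 (mod 4)` (`⟺ 2 ∣ m`) and `A_p = 0` for `p ≡ 3 (mod 4)`;
* ★★ `hasseCoeff_jZero_ne_zero` / `hasseCoeff_j1728_ne_zero` — over `𝔽_p` (`ZMod p`): `A_p ≠ 0` when `b ≠ 0` and `p ≡ 1 (mod 3)`, resp.
  `a ≠ 0` and `p ≡ 1 (mod 4)` (`C(m, k) ≢ 0 (mod p)` as `m < p`, `UniversalOrdinary.natCast_choose_ne_zero`) — DEURING's criterion in the
  direction the ordinary roads use: `y² = x³ + b` is ORDINARY at `p ≡ 1 (mod 3)`, `y² = x³ + a x` is ORDINARY at `p ≡ 1 (mod 4)`; and the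
  `iff` forms `hasseCoeff_jZero_eq_zero_iff` / `hasseCoeff_j1728_eq_zero_iff` for `p ≥ 5`.

Purpose: the (G)-ORDINARY potentially good additive cells at EVERY prime `p ≥ 11` (crux TDS11 `stmt-BirchSwinnertonDyer-22228` of route
`EdixhovenFibreFiveSeven`, and the `p > 7` Manin lever of `TeichmullerTwistDescent`): their good models over `ℤ_p[p^{1/e}]` reduce to exactly these
two CM fibres (`e = 4 ↦ j = 1728`, `e ∈ {3, 6} ↦ j = 0`), and (G)-ordinarity forces `e ∣ p − 1`, i.e. the congruences above. Infrastructure only;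
BSD is not proved by any of this.

## References
* [SilvermanAEC2009] J. H. Silverman, *AEC* (2009), V.4.1 (Deuring's criterion / the Hasse invariant), Examples V.4.4 (`y² = x³ + 1`) and
  V.4.5 (`y² = x³ + x`).
* [Deuring1941] M. Deuring, Abh. Math. Sem. Hamburg 14 (1941) (the endomorphism rings; supersingular `j = 0, 1728`).
-/

noncomputable section

open scoped Classical
open Polynomial Finset

namespace Literature.NumberTheory.EllipticCurves

open Literature.NumberTheory.EllipticCurves.UniversalOrdinary

section Coefficients

variable {S : Type*} [CommRing S]

/-- **`[x^{2m}](x³ + b)^m`**: `C(m, 2m/3)·b^{m/3}` when `3 ∣ m`, and `0` otherwise (the only monomial of `(x³ + b)^m` in degree `2m` is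
`C(m,k) x^{3k} b^{m−k}` with `3k = 2m`). [cite: SilvermanAEC2009, Example V.4.4] -/
theorem coeff_cube_add_pow_of_a₄_zero (b : S) (m : ℕ) :
    ((X ^ 3 + C (0 : S) * X + C b) ^ m).coeff (2 * m) = if 3 ∣ m then (m.choose (2 * m / 3) : S) * b ^ (m / 3) else 0 := by
  rw [coeff_cube_add_pow]
  -- inner sums: only `j = k` survives (`0^{k-j}`), with the condition `3k = 2m`
  have hinner : ∀ k ∈ range (m + 1), (∑ j ∈ range (k + 1),
      (if k + 2 * j = 2 * m then (m.choose k : S) * (k.choose j : S) * (0 : S) ^ (k - j) * b ^ (m - k) else 0)) =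
      if 3 * k = 2 * m then (m.choose k : S) * b ^ (m - k) else 0 := by
    intro k _
    rw [sum_eq_single k]
    · by_cases h : 3 * k = 2 * m
      · rw [if_pos (by omega), if_pos h, Nat.sub_self, pow_zero, Nat.choose_self, Nat.cast_one]; ring
      · rw [if_neg (by omega), if_neg h]
    · intro j hj hjk
      have hjk' : j < k := lt_of_le_of_ne (Nat.lt_succ_iff.mp (mem_range.mp hj)) hjk
      by_cases h : k + 2 * j = 2 * m
      · rw [if_pos h, zero_pow (by omega)]; ring
      · rw [if_neg h]
    · intro hk; exact absurd (self_mem_range_succ k) hk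
  rw [sum_congr rfl hinner]
  by_cases h3 : 3 ∣ m
  · obtain ⟨n, rfl⟩ := h3
    rw [if_pos (dvd_mul_right 3 n), sum_eq_single (2 * n)]
    · have e1 : 2 * (3 * n) / 3 = 2 * n := by omega
      have e2 : 3 * n / 3 = n := by omega
      have e3 : 3 * n - 2 * n = n := by omega
      rw [if_pos (by ring), e1, e2, e3]
    · intro k _ hk; rw [if_neg (by omega)]
    · intro hk; exfalso; exact hk (mem_range.mpr (by omega))
  · rw [if_neg h3]
    exact sum_eq_zero fun k _ => if_neg fun h => h3 ⟨k, by omega⟩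

/-- **`[x^{2m}](x³ + a x)^m`**: `C(m, m/2)·a^{m/2}` when `2 ∣ m`, and `0` otherwise (`(x³ + ax)^m = x^m (x² + a)^m`; the only monomial in
degree `2m` is `C(m,j) a^{m−j} x^{m+2j}` with `2j = m`). [cite: SilvermanAEC2009, Example V.4.5] -/
theorem coeff_cube_add_pow_of_a₆_zero (a : S) (m : ℕ) :
    ((X ^ 3 + C a * X + C (0 : S)) ^ m).coeff (2 * m) = if 2 ∣ m then (m.choose (m / 2) : S) * a ^ (m / 2) else 0 := by
  rw [coeff_cube_add_pow, sum_eq_single m]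
  · -- `k = m`: the inner sum over `j` with `m + 2j = 2m`
    by_cases h2 : 2 ∣ m
    · obtain ⟨n, rfl⟩ := h2
      rw [if_pos (dvd_mul_right 2 n), sum_eq_single n]
      · have e1 : 2 * n / 2 = n := by omega
        have e2 : 2 * n - n = n := by omega
        rw [if_pos (by ring), Nat.choose_self, Nat.cast_one, one_mul, Nat.sub_self, pow_zero, mul_one, e1, e2]
      · intro j _ hj; rw [if_neg (by omega)]
      · intro hn; exfalso; exact hn (mem_range.mpr (by omega))
    · rw [if_neg h2]
      exact sum_eq_zero fun j _ => if_neg fun h => h2 ⟨j, by omega⟩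
  · -- `k < m`: the factor `0^{m-k}` kills the term
    intro k hk hkm
    have hkm' : k < m := lt_of_le_of_ne (Nat.lt_succ_iff.mp (mem_range.mp hk)) hkm
    exact sum_eq_zero fun j _ => by
      by_cases h : k + 2 * j = 2 * m
      · rw [if_pos h, zero_pow (by omega)]; ring
      · rw [if_neg h]
  · intro hm; exact absurd (self_mem_range_succ m) hm

end Coefficients

section Hasse

variable {S : Type*} [CommRing S]

/-- `p − 1 = 2·((p − 1)/2)` for an odd prime. [folklore] -/
private theorem sub_one_eq_two_mul_div_of_prime_ne_two {p : ℕ} (hp : p.Prime) (hp2 : p ≠ 2) : p - 1 = 2 * ((p - 1) / 2) := by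
  obtain ⟨k, hk⟩ := hp.eq_two_or_odd'.resolve_left hp2
  omega

/-- ★ **`A_p(y² = x³ + b) = 4^m · C(m, 2m/3) · b^{m/3}`** (`m = (p−1)/2`) at an odd prime `p` with `3 ∣ m`, i.e. `p ≡ 1 (mod 3)`.
[cite: SilvermanAEC2009, V.4.1 and Example V.4.4] -/
theorem hasseCoeff_jZero_of_three_dvd (b : S) {p : ℕ} (hp : p.Prime) (hp2 : p ≠ 2) (h3 : 3 ∣ (p - 1) / 2) :
    (⟨0, 0, 0, 0, b⟩ : WeierstrassCurve S).hasseCoeff p =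
      4 ^ ((p - 1) / 2) * (((p - 1) / 2).choose (2 * ((p - 1) / 2) / 3) : S) * b ^ ((p - 1) / 2 / 3) := by
  rw [hasseCoeff_short, sub_one_eq_two_mul_div_of_prime_ne_two hp hp2, Nat.mul_div_cancel_left _ two_pos,
    coeff_cube_add_pow_of_a₄_zero, if_pos h3, mul_assoc]

/-- ★ **`A_p(y² = x³ + b) = 0`** at an odd prime `p` with `3 ∤ (p−1)/2`, i.e. `p ≡ 2 (mod 3)` (SUPERSINGULAR, Deuring).
[cite: SilvermanAEC2009, V.4.1 and Example V.4.4] -/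
theorem hasseCoeff_jZero_eq_zero_of_not_three_dvd (b : S) {p : ℕ} (hp : p.Prime) (hp2 : p ≠ 2) (h3 : ¬ 3 ∣ (p - 1) / 2) :
    (⟨0, 0, 0, 0, b⟩ : WeierstrassCurve S).hasseCoeff p = 0 := by
  rw [hasseCoeff_short, sub_one_eq_two_mul_div_of_prime_ne_two hp hp2, Nat.mul_div_cancel_left _ two_pos,
    coeff_cube_add_pow_of_a₄_zero, if_neg h3, mul_zero]

/-- ★ **`A_p(y² = x³ + a x) = 4^m · C(m, m/2) · a^{m/2}`** (`m = (p−1)/2`) at an odd prime `p` with `2 ∣ m`, i.e. `p ≡ 1 (mod 4)`.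
[cite: SilvermanAEC2009, V.4.1 and Example V.4.5] -/
theorem hasseCoeff_j1728_of_two_dvd (a : S) {p : ℕ} (hp : p.Prime) (hp2 : p ≠ 2) (h2 : 2 ∣ (p - 1) / 2) :
    (⟨0, 0, 0, a, 0⟩ : WeierstrassCurve S).hasseCoeff p =
      4 ^ ((p - 1) / 2) * (((p - 1) / 2).choose ((p - 1) / 2 / 2) : S) * a ^ ((p - 1) / 2 / 2) := by
  rw [hasseCoeff_short, sub_one_eq_two_mul_div_of_prime_ne_two hp hp2, Nat.mul_div_cancel_left _ two_pos,
    coeff_cube_add_pow_of_a₆_zero, if_pos h2, mul_assoc]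

/-- ★ **`A_p(y² = x³ + a x) = 0`** at an odd prime `p` with `2 ∤ (p−1)/2`, i.e. `p ≡ 3 (mod 4)` (SUPERSINGULAR, Deuring).
[cite: SilvermanAEC2009, V.4.1 and Example V.4.5] -/
theorem hasseCoeff_j1728_eq_zero_of_not_two_dvd (a : S) {p : ℕ} (hp : p.Prime) (hp2 : p ≠ 2) (h2 : ¬ 2 ∣ (p - 1) / 2) :
    (⟨0, 0, 0, a, 0⟩ : WeierstrassCurve S).hasseCoeff p = 0 := by
  rw [hasseCoeff_short, sub_one_eq_two_mul_div_of_prime_ne_two hp hp2, Nat.mul_div_cancel_left _ two_pos,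
    coeff_cube_add_pow_of_a₆_zero, if_neg h2, mul_zero]

/-- `3 ∣ (p − 1)/2 ⟺ p ≡ 1 (mod 3)` for an odd prime `p`. [folklore] -/
private theorem three_dvd_div_two_iff {p : ℕ} (hp : p.Prime) (hp2 : p ≠ 2) : 3 ∣ (p - 1) / 2 ↔ p % 3 = 1 := by
  obtain ⟨k, hk⟩ := hp.eq_two_or_odd'.resolve_left hp2
  have hp1 : 1 ≤ p := hp.one_le
  constructor
  · rintro ⟨n, hn⟩; omega
  · intro h; exact ⟨(p - 1) / 6, by omega⟩

/-- `2 ∣ (p − 1)/2 ⟺ p ≡ 1 (mod 4)` for an odd prime `p`. [folklore] -/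
private theorem two_dvd_div_two_iff {p : ℕ} (hp : p.Prime) (hp2 : p ≠ 2) : 2 ∣ (p - 1) / 2 ↔ p % 4 = 1 := by
  obtain ⟨k, hk⟩ := hp.eq_two_or_odd'.resolve_left hp2
  constructor
  · rintro ⟨n, hn⟩; omega
  · intro h; exact ⟨(p - 1) / 4, by omega⟩

end Hasse

section Deuring

variable {p : ℕ} [hpF : Fact p.Prime]

/-- `(4 : 𝔽_p)^m ≠ 0` for an odd prime `p`. [folklore] -/
private theorem four_pow_ne_zero_zmod (hp2 : p ≠ 2) (m : ℕ) : ((4 : ZMod p) ^ m) ≠ 0 := by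
  refine pow_ne_zero _ ?_
  have h4 : ((4 : ℕ) : ZMod p) ≠ 0 := by
    rw [Ne, ZMod.natCast_eq_zero_iff]
    intro h
    have h2 : p ∣ 2 ^ 2 := by simpa using h
    exact hp2 ((Nat.prime_dvd_prime_iff_eq hpF.out Nat.prime_two).mp (hpF.out.dvd_of_dvd_pow h2))
  exact_mod_cast h4

/-- ★★ **Deuring for `j = 0`, ordinary direction: `A_p(y² = x³ + b) ≠ 0` over `𝔽_p` for `p ≡ 1 (mod 3)` and `b ≠ 0`** (`4^m`, `C(m, 2m/3)`
with `m < p`, and `b^{m/3}` are all nonzero in the field `𝔽_p`). [cite: SilvermanAEC2009, V.4.1 and Example V.4.4] -/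
theorem hasseCoeff_jZero_ne_zero (hp2 : p ≠ 2) (hp3 : p % 3 = 1) {b : ZMod p} (hb : b ≠ 0) :
    (⟨0, 0, 0, 0, b⟩ : WeierstrassCurve (ZMod p)).hasseCoeff p ≠ 0 := by
  have hp : p.Prime := hpF.out
  rw [hasseCoeff_jZero_of_three_dvd b hp hp2 ((three_dvd_div_two_iff hp hp2).mpr hp3)]
  refine mul_ne_zero (mul_ne_zero (four_pow_ne_zero_zmod hp2 _) ?_) (pow_ne_zero _ hb)
  exact natCast_choose_ne_zero (by omega) (by have := hp.two_le; omega)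

/-- ★★ **Deuring for `j = 1728`, ordinary direction: `A_p(y² = x³ + a x) ≠ 0` over `𝔽_p` for `p ≡ 1 (mod 4)` and `a ≠ 0`.**
[cite: SilvermanAEC2009, V.4.1 and Example V.4.5] -/
theorem hasseCoeff_j1728_ne_zero (hp4 : p % 4 = 1) {a : ZMod p} (ha : a ≠ 0) :
    (⟨0, 0, 0, a, 0⟩ : WeierstrassCurve (ZMod p)).hasseCoeff p ≠ 0 := by
  have hp : p.Prime := hpF.out
  have hp2 : p ≠ 2 := by rintro rfl; norm_num at hp4
  rw [hasseCoeff_j1728_of_two_dvd a hp hp2 ((two_dvd_div_two_iff hp hp2).mpr hp4)]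
  refine mul_ne_zero (mul_ne_zero (four_pow_ne_zero_zmod hp2 _) ?_) (pow_ne_zero _ ha)
  exact natCast_choose_ne_zero (Nat.div_le_self _ _) (by have := hp.two_le; omega)

/-- ★★ **Deuring's criterion for `j = 0` at `p ≥ 5`**: for `b ∈ 𝔽_pˣ`, `A_p(y² = x³ + b) = 0 ⟺ p ≡ 2 (mod 3)`.
[cite: SilvermanAEC2009, V.4.1 and Example V.4.4] -/
theorem hasseCoeff_jZero_eq_zero_iff (hp5 : 5 ≤ p) {b : ZMod p} (hb : b ≠ 0) :
    (⟨0, 0, 0, 0, b⟩ : WeierstrassCurve (ZMod p)).hasseCoeff p = 0 ↔ p % 3 = 2 := by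
  have hp : p.Prime := hpF.out
  have hp2 : p ≠ 2 := by omega
  have hp3 : p % 3 ≠ 0 := fun h => by
    have h3 : 3 ∣ p := Nat.dvd_of_mod_eq_zero h
    have := (Nat.prime_dvd_prime_iff_eq Nat.prime_three hp).mp h3
    omega
  constructor
  · intro h
    by_contra h2
    exact hasseCoeff_jZero_ne_zero hp2 (by omega) hb h
  · intro h
    exact hasseCoeff_jZero_eq_zero_of_not_three_dvd b hp hp2 (fun h3' => by rw [three_dvd_div_two_iff hp hp2] at h3'; omega)

/-- ★★ **Deuring's criterion for `j = 1728` at odd `p`**: for `a ∈ 𝔽_pˣ`, `A_p(y² = x³ + a x) = 0 ⟺ p ≡ 3 (mod 4)`.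
[cite: SilvermanAEC2009, V.4.1 and Example V.4.5] -/
theorem hasseCoeff_j1728_eq_zero_iff (hp2 : p ≠ 2) {a : ZMod p} (ha : a ≠ 0) :
    (⟨0, 0, 0, a, 0⟩ : WeierstrassCurve (ZMod p)).hasseCoeff p = 0 ↔ p % 4 = 3 := by
  have hp : p.Prime := hpF.out
  obtain ⟨k, hk⟩ := hp.eq_two_or_odd'.resolve_left hp2
  constructor
  · intro h
    by_contra h4
    exact hasseCoeff_j1728_ne_zero (by omega) ha h
  · intro h
    exact hasseCoeff_j1728_eq_zero_of_not_two_dvd a hp hp2 (fun h2' => by rw [two_dvd_div_two_iff hp hp2] at h2'; omega)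

end Deuring

end Literature.NumberTheory.EllipticCurves

end
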